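import Summits.QuantumAdvantage.QuantumAdvantage.Theorems.CubicForrelationNearExactIsExactEighteenPairing
import Summits.QuantumAdvantage.QuantumAdvantage.Theorems.CubicForrelationNearExactIsExactLadderEnvelope

/-!
# Crux `CubicForrelation.NearExactIsExact` (stmt-QuantumAdvantage-14043) — n = 20 two-sided analysis: Parseval, budget and pairing

Certificate seat `b2b-cforr-cert` (gen 6).  HONEST FRAMING: preparatory lemmas for theorems about cubic Boolean pairs on 20 bits (finite slice
`n = 20` of the crux; the boundary value `Φ = 127/128` of the certified bound `θ₂₀ ≤ 127/128`, `theta_twenty_bounds`) — NOT summit progress.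

With `W_g = 128u` (Ax on 20 bits), `s = (−1)^f` and the residual `τ = u − 8s` (a bent `g` has `|u| = 8`):
* `tp20_sum_u_sq`: `Σ_x u(x)² = 2²⁶` (Parseval);
* `tp20_budget`: `Σ_x (u − 8s)² = 2²⁷·(1 − Φ(f,g))`  (so `Φ ≥ 127/128 ⟺ Σ τ² ≤ 2²⁰`);
* `tp20_pairing`: `Σ_y (−1)^{g(y)}·τ̂(y) = 2³³·(1 − Φ(f,g))` (`= 2²⁶` at the boundary).

References: J. Ax (1964) / R. J. McEliece (1972); R. O'Donnell (2014) §1.4, §3.3; S. Aaronson, A. Ambainis, SIAM J. Comput. 47 (2018) §1.1.1.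
Everything below is proved from Mathlib and the tree; axioms are the standard three.
-/

set_option linter.dupNamespace false -- D-0017: single-problem summit ⇒ `QuantumAdvantage.QuantumAdvantage` by design

noncomputable section

namespace Summit.QuantumAdvantage.QuantumAdvantage.Theorems.CubicForrelation.NearExactIsExact

open Finset
open Literature.Computability.QuantumComplexity
open Literature.Computability.QuantumComplexity.DerivativeWalsh (W)

/-- Parseval at level 7 on 20 bits: `W_g = 128u ⇒ Σ_x u(x)² = 2²⁶`. [folklore] -/
theorem tp20_sum_u_sq (g : (Fin (10 + 10) → Bool) → Bool) (u : (Fin (10 + 10) → Bool) → ℤ)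
    (hu : ∀ x, W (fun y => signOf (g y)) x = (2 : ℝ) ^ 7 * (u x : ℝ)) : ∑ x, u x ^ 2 = 2 ^ 26 := by
  have hP := DerivativeWalsh.sum_W_sq (fun y => signOf (g y))
  have h1 : ∀ b : Bool, signOf b ^ 2 = (1 : ℝ) := fun b => by unfold signOf; split_ifs <;> norm_num
  have hL : ∑ x, W (fun y => signOf (g y)) x ^ 2 = (2 : ℝ) ^ 14 * ∑ x, (u x : ℝ) ^ 2 := by
    rw [mul_sum]
    exact sum_congr rfl fun x _ => by rw [hu x]; ring
  rw [hL, sum_congr rfl fun y _ => h1 _, sum_const, card_univ, Fintype.card_fun, Fintype.card_bool, Fintype.card_fin] at hP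
  norm_num at hP
  have h2 : ∑ x, (u x : ℝ) ^ 2 = 2 ^ 26 := by linarith
  exact_mod_cast h2

/-- **Two-sided budget on 20 bits.** With `W_g = 128u` and `s = (−1)^f`: `Σ_x (u − 8s)² = 2²⁷·(1 − Φ(f,g))`. [this work] -/
theorem tp20_budget (f g : (Fin (10 + 10) → Bool) → Bool) (u : (Fin (10 + 10) → Bool) → ℤ)
    (hu : ∀ x, W (fun y => signOf (g y)) x = (2 : ℝ) ^ 7 * (u x : ℝ)) :
    ((∑ x, (u x - 8 * sZ (f x)) ^ 2 : ℤ) : ℝ) = (2 : ℝ) ^ 27 * (1 - forrelation f g) := by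
  have hsq : ∑ x, ((u x : ℝ)) ^ 2 = 2 ^ 26 := by exact_mod_cast tp20_sum_u_sq g u hu
  have hΦ := vg_two_pow_mul_forrelation f g
  have e : ∀ x : Fin (10 + 10) → Bool, ((u x : ℝ) - 8 * (sZ (f x) : ℝ)) ^ 2 =
      (u x : ℝ) ^ 2 - (1 / 8) * (signOf (f x) * W (fun y => signOf (g y)) x) + 64 := by
    intro x
    have hs2 : signOf (f x) ^ 2 = 1 := BuzetChailloux.signOf_sq _
    rw [tp_sZ_cast, hu x]
    nlinarith [hs2]
  push_cast
  rw [sum_congr rfl fun x _ => e x, sum_add_distrib, sum_sub_distrib, ← mul_sum, hsq, ← hΦ, sum_const, card_univ,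
    Fintype.card_fun, Fintype.card_bool, Fintype.card_fin]
  norm_num
  ring

/-- **The two-sided pairing identity on 20 bits.** With `W_g = 128u`: `Σ_y (−1)^{g(y)}·(u − 8(−1)^f)^(y) = 2³³·(1 − Φ(f,g))`. [this work] -/
theorem tp20_pairing (f g : (Fin (10 + 10) → Bool) → Bool) (u : (Fin (10 + 10) → Bool) → ℤ)
    (hu : ∀ x, W (fun y => signOf (g y)) x = (2 : ℝ) ^ 7 * (u x : ℝ)) :
    ∑ y, signOf (g y) * W (fun x => (u x : ℝ) - 8 * signOf (f x)) y = (2 : ℝ) ^ 33 * (1 - forrelation f g) := by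
  rw [fl1_pairing]
  have hΦ := vg_two_pow_mul_forrelation f g
  have hsq : ∑ x, ((u x : ℝ)) ^ 2 = 2 ^ 26 := by exact_mod_cast tp20_sum_u_sq g u hu
  have e : ∀ x, ((u x : ℝ) - 8 * signOf (f x)) * W (fun y => signOf (g y)) x =
      128 * (u x : ℝ) ^ 2 - 8 * (signOf (f x) * W (fun y => signOf (g y)) x) := by
    intro x; rw [hu x]; ring
  rw [sum_congr rfl fun x _ => e x, sum_sub_distrib, ← mul_sum, ← mul_sum, hsq, ← hΦ]
  norm_num
  ring

end Summit.QuantumAdvantage.QuantumAdvantage.Theorems.CubicForrelation.NearExactIsExact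

end
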